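import Mathlib
import HarnessLib
import Literature.Analysis.FluidPDE.LocalTypeI
import Literature.Analysis.FluidPDE.LocalTypeILscPressure

/-!
# `SymmetryModuliCount.ForcedSymmetry` (crux stmt-NavierStokesRegularity-4052), line
# `recurrent-closing`, stub `stub_oscTimeIntegration`: time integration of the slice
# oscillation bounds of the pressure

Support file (everything proved, kind = proof) for the lead's skeleton of the line
`recurrent-closing` (`Cruxes/ForcedSymmetry/Lines/recurrent_closing.lean`), sub-stub 1c
`stub_oscTimeIntegration`.

If a pressure `p` has slice oscillations
`∫_{B(x₀,1)} |p(τ) − [p(τ)]_{B(x₀,1)}|^{3/2} ≤ M₁ (−τ)^{−3/4} + M₂` for all `τ < 0` and all centres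
`x₀`, then on every unit parabolic ball `Q(z,1)` with top time `z.1 ≤ 0` Albritton–Barker's
mean-free pressure quantity `D` (`Literature.Analysis.FluidPDE.cknDOsc`) obeys
`D(Q(z,1); p) ≤ 4 M₁ + M₂`.

Proof: at `r = 1` the prefactor of `cknDOsc` is `1` and the cylinder is
`(z.1 − 1, z.1) × B(z.2, 1)`; the restricted Lebesgue measure on it is the product of the
restrictions (`volume_restrict_prod_eq`), so Tonelli in inequality form (`lintegral_prod_le`, no
measurability needed) bounds the space–time integral by the iterated one. Each time slice
`τ ∈ (z.1 − 1, z.1)` has `τ < 0`, so the hypothesis bounds the inner integral by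
`ENNReal.ofReal (M₁ (−τ)^{−3/4} + M₂)`, and
`∫_{z.1−1}^{z.1} (−τ)^{−3/4} dτ = 4 ((1 − z.1)^{1/4} − (−z.1)^{1/4}) ≤ 4` by subadditivity of
`x ↦ x^{1/4}`.

## References

* D. Albritton, T. Barker, *On local Type I singularities of the Navier–Stokes equations and
  Liouville theorems*, J. Math. Fluid Mech. 21 (2019), §1 (display defining `D`).
  [AlbrittonBarker2019]
-/

noncomputable section

set_option linter.dupNamespace false

open MeasureTheory Set Metric Function
open scoped ENNReal

namespace Summit.NavierStokesRegularity.NavierStokesRegularity.Theorems.SymmetryModuliCountForcedSymmetry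

open Literature.Analysis.FluidPDE

/-- `x ↦ (−x)^r` is interval integrable (Lebesgue) on every interval when `−1 < r`. -/
theorem intervalIntegrable_neg_rpow (a b : ℝ) {r : ℝ} (hr : -1 < r) :
    IntervalIntegrable (fun x : ℝ => (-x) ^ r) volume a b := by
  have h0 := intervalIntegral.intervalIntegrable_rpow' (a := -a) (b := -b) hr
  have h1 := (IntervalIntegrable.iff_comp_neg enorm_ne_top).mp h0
  simpa only [neg_neg] using h1

/-- The elementary time integral: `∫_{a−1}^{a} (−x)^{−3/4} dx ≤ 4` for `a ≤ 0` (it equals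
`4 ((1 − a)^{1/4} − (−a)^{1/4})`, and `x ↦ x^{1/4}` is subadditive). -/
theorem integral_neg_rpow_le_four {a : ℝ} (ha : a ≤ 0) :
    ∫ x in (a - 1)..a, (-x) ^ (-(3 / 4 : ℝ)) ≤ 4 := by
  have h : ∫ x in (a - 1)..a, (-x) ^ (-(3 / 4 : ℝ)) = ∫ x in -a..-(a - 1), x ^ (-(3 / 4 : ℝ)) :=
    intervalIntegral.integral_comp_neg (fun x : ℝ => x ^ (-(3 / 4 : ℝ)))
  rw [h, integral_rpow (Or.inl (by norm_num))]
  have key : (-(a - 1)) ^ (-(3 / 4 : ℝ) + 1) ≤ (-a) ^ (-(3 / 4 : ℝ) + 1) + 1 := by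
    have h' := Real.rpow_add_le_add_rpow (neg_nonneg.mpr ha) zero_le_one
      (by norm_num : (0 : ℝ) ≤ -(3 / 4 : ℝ) + 1) (by norm_num)
    rw [Real.one_rpow] at h'
    have h1 : -(a - 1) = -a + 1 := by ring
    rw [h1]
    exact h'
  rw [div_le_iff₀ (by norm_num : (0 : ℝ) < -(3 / 4 : ℝ) + 1)]
  linarith

/-- **Sub-stub 1c — time integration of the slice bounds.**  If a pressure `p`, continuous on
`(−∞,0) × ℝ³`, has slice oscillations `∫_{B(x₀,1)} |p(τ) − [p(τ)]_{B(x₀,1)}|^{3/2} ≤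
M₁ (−τ)^{−3/4} + M₂` for all `τ < 0` and all centres, then on every unit parabolic ball `Q(z,1)`
with top time `z.1 ≤ 0` Albritton–Barker's mean-free pressure quantity obeys
`D_osc(Q(z,1); p) ≤ 4 M₁ + M₂` (Tonelli in inequality form `lintegral_prod_le`, and
`∫_{z.1−1}^{z.1} (−τ)^{−3/4} dτ ≤ 4`). The continuity hypothesis is not used. -/
theorem stub_oscTimeIntegration :
    ∀ (M₁ M₂ : ℝ) (p : ℝ → EuclideanSpace ℝ (Fin 3) → ℝ), 0 ≤ M₁ → 0 ≤ M₂ →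
      ContinuousOn (Function.uncurry p) (Set.Iio 0 ×ˢ Set.univ) →
      (∀ τ < (0 : ℝ), ∀ x₀ : EuclideanSpace ℝ (Fin 3),
        ∫⁻ x in ball x₀ 1, ‖p τ x - ⨍ y in ball x₀ 1, p τ y‖ₑ ^ (3 / 2 : ℝ) ≤
          ENNReal.ofReal (M₁ * (-τ) ^ (-(3 / 4 : ℝ)) + M₂)) →
      ∀ z : ℝ × EuclideanSpace ℝ (Fin 3), z.1 ≤ 0 → cknDOsc 1 z p ≤ ENNReal.ofReal (4 * M₁ + M₂) := by
  intro M₁ M₂ p hM₁ hM₂ _hp hslice z hz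
  -- normalise the prefactor and the cylinder at `r = 1`, and split the measure
  simp only [cknDOsc, Literature.Analysis.FluidPDE.parabolicCylinder, ENNReal.ofReal_one, one_pow,
    inv_one, one_mul]
  rw [volume_restrict_prod_eq]
  refine (lintegral_prod_le _).trans ?_
  -- integrability and nonnegativity of the time profile
  have hle : z.1 - 1 ≤ z.1 := by linarith
  have hI₁ : IntervalIntegrable (fun τ : ℝ => M₁ * (-τ) ^ (-(3 / 4 : ℝ))) volume (z.1 - 1) z.1 :=
    (intervalIntegrable_neg_rpow _ _ (by norm_num)).const_mul M₁
  have hI₂ : IntervalIntegrable (fun _ : ℝ => M₂) volume (z.1 - 1) z.1 := intervalIntegrable_const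
  have hI : IntervalIntegrable (fun τ : ℝ => M₁ * (-τ) ^ (-(3 / 4 : ℝ)) + M₂) volume (z.1 - 1) z.1 :=
    hI₁.add hI₂
  have hint : IntegrableOn (fun τ : ℝ => M₁ * (-τ) ^ (-(3 / 4 : ℝ)) + M₂) (Ioo (z.1 - 1) z.1) :=
    hI.1.mono_set Ioo_subset_Ioc_self
  have hnn : 0 ≤ᵐ[volume.restrict (Ioo (z.1 - 1) z.1)]
      (fun τ : ℝ => M₁ * (-τ) ^ (-(3 / 4 : ℝ)) + M₂) := by
    filter_upwards [ae_restrict_mem measurableSet_Ioo] with τ hτ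
    have hτ0 : 0 ≤ -τ := by linarith [hτ.2]
    exact add_nonneg (mul_nonneg hM₁ (Real.rpow_nonneg hτ0 _)) hM₂
  -- the real time integral is at most `4 M₁ + M₂`
  have hreal : ∫ τ in Ioo (z.1 - 1) z.1, (M₁ * (-τ) ^ (-(3 / 4 : ℝ)) + M₂) ≤ 4 * M₁ + M₂ := by
    rw [← integral_Ioc_eq_integral_Ioo, ← intervalIntegral.integral_of_le hle,
      intervalIntegral.integral_add hI₁ hI₂, intervalIntegral.integral_const_mul,
      intervalIntegral.integral_const, smul_eq_mul]
    have h4 := integral_neg_rpow_le_four hz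
    nlinarith [mul_le_mul_of_nonneg_left h4 hM₁]
  calc ∫⁻ τ in Ioo (z.1 - 1) z.1, ∫⁻ x in ball z.2 1,
        ‖p τ x - ⨍ y in ball z.2 1, p τ y‖ₑ ^ (3 / 2 : ℝ)
      ≤ ∫⁻ τ in Ioo (z.1 - 1) z.1, ENNReal.ofReal (M₁ * (-τ) ^ (-(3 / 4 : ℝ)) + M₂) :=
        setLIntegral_mono' measurableSet_Ioo fun τ hτ => hslice τ (by linarith [hτ.2]) z.2
    _ = ENNReal.ofReal (∫ τ in Ioo (z.1 - 1) z.1, (M₁ * (-τ) ^ (-(3 / 4 : ℝ)) + M₂)) :=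
        (ofReal_integral_eq_lintegral_ofReal hint.integrable hnn).symm
    _ ≤ ENNReal.ofReal (4 * M₁ + M₂) := ENNReal.ofReal_le_ofReal hreal

end Summit.NavierStokesRegularity.NavierStokesRegularity.Theorems.SymmetryModuliCountForcedSymmetry

end
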